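/-
Copyright (c) 2026. All rights reserved.
Released under Apache 2.0 license as described in the file LICENSE.
Authors: HodgeCM publication cell (pub-hodgecm), GR lane, seat GR-2 (`pub-hodgecm-own-hyp34`).
-/
import Literature.NumberTheory.GelbartRogawski1991.DoubledWeilRepresentationArchLiftGen
import Literature.NumberTheory.GelbartRogawski1991.DoubledWeilRepresentationArchTwistGen
import Literature.NumberTheory.GelbartRogawski1991.DoubledUnitaryArchSiegelDiagonalModulusGen
import Literature.NumberTheory.GelbartRogawski1991.DoubledGramDiagonal
import Literature.NumberTheory.Weil1964.ArchUnitaryWeilHalfGenQuotient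
import HarnessLib

/-!
# The doubled Weil representation, archimedean half (III), general `E/F` with `E` totally complex:
# existence of `IsArchHalf χ s_∞` from the archimedean twist

General-quadratic-extension twin (namespace `GRConstructionGen`) of `DoubledWeilRepresentationArchHalf` (CM case).
For `E/F` quadratic with `E` TOTALLY COMPLEX and `F` ARBITRARY (real and complex places), and DIAGONAL Gram data
`TV = diag(dV)`, `TW = diag(dW)` over `F`, the generic theorem `GRConstructionGen.isArchHalf_twist_archLift`
(`DoubledWeilRepresentationArchLiftGen`) is instantiated at

* the frame `eW := Weil1964.genFrame` — sign-frame scalings at the real places (`placeOverReal`, Galois-fixed,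
  `QuadExtTotallyComplexPlaces`), scaling `1` and the coordinate twist at the complex places (`placeOverComplex`);
* the section `sW := Weil1964.archWeilSectionGen x` = (Folland's `det^{1/2}`-normalised unitary section on the real
  block) ⊠ (the conjugated Siegel–Levi section on the complex block), its dictionary
  `archPhaseMap_eq_coe_proj_archWeilSectionGen` and its lift `sa := archWeilHalfGen` (`ArchUnitaryWeilHalfGen`;
  `hsa := rfl`);
* the modulus input `hdiag :=` `exists_archAct_diagPair_det_eq_modDelta_sq_gen` (`DoubledUnitaryArchSiegelDiagonalModulusGen`);
* Folland's quotient character of `sW`: `∏_{v real} (det g_{w(v)})⁻¹` (`quot_archWeilSectionGen`,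
  `ArchUnitaryWeilHalfGenQuotient`: the complex places contribute nothing).

Results: **`exists_isArchHalf_of_archDetTwist`** — given an ARCHIMEDEAN TWIST `η` (a continuous character of
`H(F ⊗ ℝ)` with `η(g)² · ∏_{v real} (det g_{w(v)})⁻¹ = χ(det_Δ (g,1))²` on `P_Δ(F ⊗ ℝ)`) there is an archimedean half
`∃ sa, IsArchHalf F E c hcδ hδ hd e (diag dV) … (diag dW) … χ sa`; and **`exists_isArchHalf_gen`** — THE ARCHIMEDEAN
HALF EXISTS for every unitary Hecke character `χ` of `E` with `χ|_{𝕀_F} = ε_{E/F}` (`IsSplittingCharExt F E 1 χ`), the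
twist being `DoubledWeilRepresentationArchTwistGen.exists_archDetTwist_chiDet_gen` (type-(i) part by the GR-1 lane,
complex places of `F` by `QuadExtSplittingCharArchTwistComplex`).  With the finite half
(`DoubledWeilRepresentationLocalFamilyGen`) and `CompatibleSplittingQuadraticDoublingGen` this is the archimedean input
of [GelbartRogawski1991, Prop. 3.1.1] for every quadratic `E/F` with `E` totally complex
(`Prop311AsPrintedOfArchHalf.prop311AsPrinted_of_diagonalArchHalf` consumes it together with the real-split case).

Topic `NumberTheory/GelbartRogawski1991`; KERNEL only: one transparent abbreviation (`t₀D`) and theorems; no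
`def … : Prop`, no named fact, no `sorry`.  Written for the stage-1 cell `pub-hodgecm` (GR lane); nothing here is a
claim of the manuscripts adjudicated by that cell; `HC_CM` is not touched.

## References
* S. Gelbart, J. Rogawski, Invent. Math. 105 (1991), §3.1 Prop. 3.1.1 p. 455 [GelbartRogawski1991].
* S. S. Kudla, Israel J. Math. 87 (1994), §3 [Kudla1994].
* A. Paul, J. Funct. Anal. 159 (1998), §1.2 (1.2.1)–(1.2.2) [Paul1998].
* M. Harris, S. S. Kudla, W. J. Sweet, J. Amer. Math. Soc. 9 (1996), §1 (1.9) [HarrisKudlaSweet1996].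
-/

set_option autoImplicit false

noncomputable section

open scoped Classical
open scoped Matrix Kronecker TensorProduct
open NumberField NumberField.InfinitePlace IsDedekindDomain
open Literature.RepresentationTheory.HeisenbergGroup
open Literature.NumberTheory.Automorphic Literature.NumberTheory.Automorphic.UnitaryGroup
open Literature.NumberTheory.Weil1964
open Literature.NumberTheory.GaloisRepresentations
open Literature.RepresentationTheory.HarrisKudlaSweet1996

namespace Literature.NumberTheory.GelbartRogawski1991.GRConstructionGen

open UnitaryDualPair

variable (F : Type) [Field F] [NumberField F] (E : Type) [Field E] [NumberField E] [Algebra F E]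
  [Algebra.IsQuadraticExtension F E]
variable (c : E ≃ₐ[F] E) {δ : E} (hcδ : c δ = -δ) (hδ : δ ≠ 0) {d : F} (hd : δ * δ = algebraMap F E d)
variable {N M n : ℕ} (e : Fin N × Fin M ≃ Fin n)
  (dV : Fin N → F) (hV : (Matrix.diagonal dV).IsSymm) (hVd : IsUnit (Matrix.diagonal dV).det) (hdV0 : ∀ i, dV i ≠ 0)
  (dW : Fin M → F) (hW : (Matrix.diagonal dW).IsSymm) (hWd : IsUnit (Matrix.diagonal dW).det) (hdW0 : ∀ j, dW j ≠ 0)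

/-! ## §1 Diagonal bookkeeping -/

/-- **`t₀^𝔻`**: the diagonal of `T^𝔻` for diagonal data, `(dV_{i} dW_{j}) ⊕ (−dV_i dW_j)` re-enumerated by `e`, `e₂`.
[cite: HarrisKudlaSweet1996, §1 (1.9)] -/
abbrev t₀D : Fin (n + n) → F := fun k =>
  Sum.elim (fun i => dV (e.symm i).1 * dW (e.symm i).2) (fun i => -(dV (e.symm i).1 * dW (e.symm i).2))
    ((e₂ (n := n)).symm k)

omit [NumberField F] in
/-- **`T^𝔻 = diag(t₀^𝔻)`** for diagonal data (the datum's `gramD` is the tree's `LocalSplitting.gramD F n (gram …)`,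
definitionally; `UnitaryDualPair.gramD_gram_diagonal`). [cite: HarrisKudlaSweet1996, §1 (1.9)] -/
theorem gramD_eq_diagonal_gen :
    gramD F e (Matrix.diagonal dV) (Matrix.diagonal dW) = Matrix.diagonal (t₀D F e dV dW) := by
  unfold gramD gramR
  exact UnitaryDualPair.gramD_gram_diagonal F e dV dW

omit [NumberField F] in
include hdV0 hdW0 in
/-- the entries of `t₀^𝔻` are non-zero. [cite: HarrisKudlaSweet1996, §1 (1.9)] -/
theorem t₀D_ne_zero (k : Fin (n + n)) : t₀D F e dV dW k ≠ 0 := by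
  unfold t₀D
  rcases (e₂ (n := n)).symm k with i | i
  · exact mul_ne_zero (hdV0 _) (hdW0 _)
  · exact neg_ne_zero.2 (mul_ne_zero (hdV0 _) (hdW0 _))

/-! ## §2 The archimedean half from the archimedean twist -/

include hdV0 hdW0 in
/-- **THE ARCHIMEDEAN HALF EXISTS GIVEN THE ARCHIMEDEAN TWIST** (`E` totally complex, `F` arbitrary): for a Hecke
character `χ` of `E` and a continuous character `η` of `H(F ⊗ ℝ)` with
`η(g)² · ∏_{v real} (det g_{w(v)})⁻¹ = χ(det_Δ (g,1))²` on `P_Δ(F ⊗ ℝ)` (`w(v) = placeOverReal v`), the twist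
`archWeilHalfGen ⊗ η` is an archimedean half: `∃ sa, IsArchHalf … χ sa`.
[cite: GelbartRogawski1991, §3.1 Prop. 3.1.1 p. 455] -/
theorem exists_isArchHalf_of_archDetTwist [IsTotallyComplex E] (χ : HeckeCharacter E)
    (η : UnitaryGroup.arch F E c (n + n) (hermD F E e (Matrix.diagonal dV) (Matrix.diagonal dW)) →* ℂˣ)
    (hηc : Continuous fun g => ((η g : ℂˣ) : ℂ))
    (hη : ∀ g : UnitaryGroup.arch F E c (n + n) (hermD F E e (Matrix.diagonal dV) (Matrix.diagonal dW)),
      IsSiegelDelta F E c e (Matrix.diagonal dV) (Matrix.diagonal dW)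
          (UnitaryGroup.archToAdelic F E c (n + n) (hermD F E e (Matrix.diagonal dV) (Matrix.diagonal dW)) g) →
        ((η g : ℂˣ) : ℂ) ^ 2 * ∏ v : {v : InfinitePlace F // v.IsReal},
          ((((archAt F E c (n + n) (hermD F E e (Matrix.diagonal dV) (Matrix.diagonal dW)) (placeOverReal F E v)
              (smul_placeOverReal F E c v) (LocalSplitting.galConj_ne_one_of_delta F E c hcδ hδ) g :
              archLocal E (n + n) (hermD F E e (Matrix.diagonal dV) (Matrix.diagonal dW)) (placeOverReal F E v)) :
              GL (Fin (n + n)) ℂ) : Matrix (Fin (n + n)) (Fin (n + n)) ℂ).det)⁻¹ =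
          ((chiDet F E c e (Matrix.diagonal dV) (Matrix.diagonal dW) χ
            (UnitaryGroup.archToAdelic F E c (n + n) (hermD F E e (Matrix.diagonal dV) (Matrix.diagonal dW)) g) : ℂˣ) : ℂ) ^ 2) :
    ∃ sa, IsArchHalf F E c hcδ hδ hd e (Matrix.diagonal dV) hV hVd (Matrix.diagonal dW) hW hWd χ sa := by
  have hc : c ≠ 1 := LocalSplitting.galConj_ne_one_of_delta F E c hcδ hδ
  have hcc : c * c = 1 := AlgEquiv.ext (LocalSplitting.galConj_apply_apply F E c hcδ hδ)
  have hTd := gramD_eq_diagonal_gen F e dV dW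
  have ht0 := t₀D_ne_zero F e dV hdV0 dW hdW0
  obtain ⟨x, hx⟩ := exists_archWeilHalfGen_lift E (n + n) (placeOverComplex F E) (t₀D F e dV dW) ht0 hTd hδ
  refine ⟨_, isArchHalf_twist_archLift F E c hcδ hδ hd e (Matrix.diagonal dV) hV hVd (Matrix.diagonal dW) hW hWd
    (UnitaryGroup.archToAdelic F E c (n + n) (hermD F E e (Matrix.diagonal dV) (Matrix.diagonal dW))) rfl
    (genFrame E c (n + n) hc (placeOverReal F E) (smul_placeOverReal F E c) (placeOverComplex F E)
      (placeOverComplex_comap F E) (t₀D F e dV dW) ht0 hcδ hδ)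
    (archWeilSectionGen E c (n + n) hc hcc (placeOverReal F E) (smul_placeOverReal F E c) (placeOverReal_comap F E)
      (placeOverComplex F E) (t₀D F e dV dW) ht0 hTd rfl hcδ hδ x)
    (adelicToSymplectic_comp_archToAdelic_finVec E c (n + n)
      (J := hermD F E e (Matrix.diagonal dV) (Matrix.diagonal dW))
      (T := gramD F e (Matrix.diagonal dV) (Matrix.diagonal dW)) rfl hcδ hδ hd (gramD_isSymm F e _ hV _ hW))
    (archPhaseMap_eq_coe_proj_archWeilSectionGen E c (n + n) hc hcc (placeOverReal F E) (smul_placeOverReal F E c)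
      (placeOverReal_comap F E) (placeOverComplex F E) (placeOverComplex_comap F E) (t₀D F e dV dW) ht0 hTd rfl hcδ hδ
      hd x hx (isUnit_archMat_gramDA F e _ hVd _ hWd))
    (archWeilHalfGen E c (n + n) hc hcc (placeOverReal F E) (smul_placeOverReal F E c) (placeOverReal_comap F E)
      (placeOverComplex F E) (placeOverComplex_comap F E) (t₀D F e dV dW) ht0 hTd rfl hcδ hδ hd x hx
      (isUnit_archMat_gramDA F e _ hVd _ hWd))
    rfl
    (fun g hS => exists_archAct_diagPair_det_eq_modDelta_sq_gen F E c hcδ hδ hd e _ hV _ hW g hS)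
    χ
    (continuous_archWeilHalfGen E c (n + n) hc hcc (placeOverReal F E) (smul_placeOverReal F E c) (placeOverReal_comap F E)
      (placeOverComplex F E) (placeOverComplex_comap F E) (t₀D F e dV dW) ht0 hTd rfl hcδ hδ hd x hx
      (isUnit_archMat_gramDA F e _ hVd _ hWd))
    η hηc (fun g hS => ?_)⟩
  rw [quot_archWeilSectionGen]
  exact hη g hS

include hdV0 hdW0 in
/-- **THE ARCHIMEDEAN HALF EXISTS** (`E` totally complex, `F` arbitrary, diagonal Gram data): for a unitary Hecke
character `χ` of `E` with `χ|_{𝕀_F} = ε_{E/F}` there is `s_∞ : H(F ⊗ ℝ) →* Mp(𝕎^𝔻)ᶜᵒⁿᵗ` over `ι^𝔻`, continuous, by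
archimedean operators, with the origin values `χ(det_Δ p) |det_Δ p|^{1/2}` on `P_Δ(F ⊗ ℝ)` — namely
`s_∞ = archWeilHalfGen ⊗ η` with the twist `η` of `exists_archDetTwist_chiDet_gen`.  CM case:
`GRConstruction.exists_isArchHalf`. [cite: GelbartRogawski1991, §3.1 Prop. 3.1.1 p. 455] -/
theorem exists_isArchHalf_gen [IsTotallyComplex E] (χ : HeckeCharacter E) (hχu : χ.IsUnitary)
    (hχ : IsSplittingCharExt F E 1 χ) :
    ∃ sa, IsArchHalf F E c hcδ hδ hd e (Matrix.diagonal dV) hV hVd (Matrix.diagonal dW) hW hWd χ sa := by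
  obtain ⟨η, hηc, hη⟩ := exists_archDetTwist_chiDet_gen F E c hcδ hδ e (Matrix.diagonal dV) hVd (Matrix.diagonal dW) hWd
    hχu hχ
  exact exists_isArchHalf_of_archDetTwist F E c hcδ hδ hd e dV hV hVd hdV0 dW hW hWd hdW0 χ η hηc hη

end Literature.NumberTheory.GelbartRogawski1991.GRConstructionGen

end
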